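/-
Copyright: pub-hodgecm formalisation cell (harness21, 2026). New file (not vendored).
-/
import Summits.HodgeConjecture.HodgeCM.Automorphic.Realisation
import Summits.HodgeConjecture.HodgeCM.Geometry.WeightVectors

/-!
# The open inputs of the proof tree as NAMED HYPOTHESES (gen 6: the package has no placeholder proofs)

Up to gen 5 the five unproved steps of the tree were placeholder STUBS (`sorryAx`) under `HodgeCM/StubTree/`
(`lemma33b_landherr`, `realisation_exists_perL`, `realisation_exists_face`, `pohlmann_span`, `qw8_sufficiency`),
so that `#print axioms HodgeCM.Assembly.COR_CM` displayed `sorryAx`.  Since gen 6 (B12 ruling: zero placeholders) the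
same five statements are `Prop`-valued DEFINITIONS, and the end-to-end theorems take the ones they need as
explicit hypotheses — exactly the harness convention for an unproved result (a named `Prop` used as a
hypothesis, never an `axiom` command, never a placeholder proof).  Nothing is asserted in this file.

* `HodgeCM.Universe.RealisationExistsPerL` — existence of the theta-realisation data in the PerL setting
  (PerL v5 §§3–4: Def 3.2, L3.3, L3.5, P3.6/T3.7, L4.1(c), L4.2, P4.3's line field; the automorphic heart).
* `HodgeCM.Universe.RealisationExistsFace` — the same over a Galois CM field `F` and any rank-four face
  (rfwf v3 §4.2, the six-item transposition audit).
* `HodgeCM.Universe.PohlmannSpan`, `HodgeCM.Universe.Qw8Sufficiency` — the two inputs of the face reduction: Pohlmann's span theorem in PRODUCT form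
  (a PUBLISHED theorem, cited not formalised: Gao–Ullmo, J. Inst. Math. Jussieu 25 (2025) no. 1, 215–249 = arXiv:2411.12249, Thm 3.1 ‘(Pohlmann)’ is the CM-algebra form, with proof, which covers products; Pohlmann 1968 Thm 1 is the simple-variety statement; the product form also follows with Deligne 1982 I §5 and is [QW8] L2.2, cf. Hazama 2003 §8; also stated in Milne arXiv:2010.08857 §1 ¶1.2) and one INTERNAL, unrefereed reduction
  ([QW8] Thm 2.5 + §3) anchored in print by Milne, Duke 96 (1999) Thm 3.2 / Cor 4.5 (its step (iv)); both defined in `HodgeCM.Geometry.WeightVectors`.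
* `HodgeCM.Universe.OpenInputs` — the record of the FOUR inputs that lie in the cone of the headline theorems
  (`COR_CM` uses `realisation_face`, `pohlmann_span`, `qw8_sufficiency`; `perL` uses `realisation_perL`).
* `HodgeCM.Lemma33bLandherr` — Landherr's CLASSIFICATION half of Lemma 3.3(b) (hermitian planes over `L/L₀`
  with equal signatures and discriminant class are isometric; Landherr 1936 — verbatim in Rogawski 1990 §1.9 pp. 9–10, Shimura 2008 Thm 2.2 p. 748): a typed
  TARGET, **PROVED since run 22 with no hypothesis**: `HodgeCM.lemma33bLandherr_holds` (`HodgeCM/Literature/NormTheoremHolds.lean`; the norm theorem for quaternion algebras `HodgeCM.Literature.Vigneras_III_4_1` and the Hasse–Minkowski theorem are THEOREMS of the package over the vendored cone `HodgeCM/Vendored/H21/**`, closure `[propext, Classical.choice, Quot.sound]`; earlier reductions: run 14 `lemma33bLandherr_of_hasseMinkowski` ⇐ `HasseMinkowskiQuinary` = O'Meara 1963 Thm 66:1, `HodgeCM/Proofs/LandherrClassification.lean`; run 21 `lemma33bLandherr_of_normTheorem`, `HodgeCM/Literature/NormTheorem.lean`; the converse `lemma33bLandherr_converse` outright, `HodgeCM/Proofs/LandherrNecessity.lean`,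 run 15).  In PerL it is consumed inside the proof of the realisation statements (Def 3.2's seesaw plane):
  in Lean as the hypothesis `hL` of the run-16 theta-route theorems (`ThetaModel.exists_seesawDatum`, `realisationExistsPerL_of`, `Model/ThetaSeparation`, `Model/NonVacuity`), avoided by the run-19 construction (`HodgeCM/Proofs/SeesawConstruction.lean`) and DISCHARGED by the theorem everywhere else (`HodgeCM/Proofs/LandherrDischarge.lean`); it is deliberately NOT a field of `OpenInputs`.  (The EXISTENCE half,
  `HodgeCM.Universe.LandherrExists`, is PROVED: `HodgeCM.landherr_exists_proof`.)

These are kept apart from the 28 MODEL FACTS `HodgeCM.Universe.ModelAxioms` (`HodgeCM.Geometry.Facts`): a model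
fact is a cited standard theorem about the intended model that never mentions Hodge classes being algebraic
(FACTS.md, AMENDMENT 2); an open input is a statement this package does not prove — one a published theorem cited not formalised (Gao–Ullmo 2025 Thm 3.1 = the CM-algebra form of Pohlmann 1968 Thm 1; product form also via Deligne 1982 I §5,
typed [QW8] L2.2; referee A S10) and one an internal, unrefereed reduction resting on a published theorem (Milne 1999), whose model-level proofs need structure
the `Universe` interface lacks (Künneth in all degrees, `H^• = ⋀^• H¹`, push-forwards); two the unrefereed automorphic existence statements of the 2001 preprint.
-/

noncomputable section

open scoped Matrix

namespace HodgeCM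

open Literature.AlgebraicGeometry.Motives (CMType)
open Literature.AlgebraicGeometry.ShimuraVarieties (conjRingHomK)

/-- **Lemma 3.3(b), Landherr classification half** (Landherr 1936 — verbatim: Rogawski, Ann. Math. Stud. 123 (1990) §1.9 pp. 9–10;
Shimura, Doc. Math. 13 (2008) Thm 2.2 p. 748 / reduction to quadratic forms: Jacobson 1940, O'Meara §66 footnote) — typed TARGET, not in the cone of the headline theorems; **PROVED since run 22** (below):
two non-degenerate diagonal hermitian planes `⟨a₀, a₁⟩`, `⟨a₂, a₃⟩` over the CM field `L` (w.r.t. `L/L₀`) with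
the same signature at every real place of `L₀` (phrased through the signs of the real numbers `τ(a_i)`) and the
same discriminant in `L₀^× / N_{L/L₀}(L^×)` are isometric (`gᴴ · diag(a₀,a₁) · g = diag(a₂,a₃)`, `g ∈ GL₂(L)`).
PROVED with NO hypothesis since run 22 (expansion seat landherr, gens 1–4): `HodgeCM.lemma33bLandherr_holds : Lemma33bLandherr` (`HodgeCM/Literature/NormTheoremHolds.lean`), through `lemma33bLandherr_of_normTheorem` (run 21, `HodgeCM/Literature/NormTheorem.lean`: ⇐ the norm theorem for quaternion algebras, Vignéras LNM 800 III Thm 4.1) and `lemma33bLandherr_of_hasseMinkowski` (run 14, `HodgeCM/Proofs/LandherrClassification.lean`: ⇐ `HasseMinkowskiQuinary` = O'Meara 1963 Thm 66:1), both inputs being THEOREMS of the package over the vendored harness-tree cone `HodgeCM/Vendored/H21/**` (Hilbert symbols, local–global principle for quadratic forms over number fields); closure `[propext, Classical.choice, Quot.sound]`.  The converse `HodgeCM.lemma33bLandherr_converse` (`HodgeCM/Proofs/LandherrNecessity.lean`, run 15) is PROVED with no input, so `HodgeCM.Literature.landherr_rank2_iff` is Landherr's rank-2 classification exactly as PerL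 l. 299 quotes it. -/
def Lemma33bLandherr : Prop :=
  ∀ (L : CMField) (a : Fin 4 → L), (∀ i, conjRingHomK L (a i) = a i) → (∀ i, a i ≠ 0) →
    (∀ τ : L →+* ℂ,
      ({decide (0 < (τ (a 0)).re), decide (0 < (τ (a 1)).re)} : Multiset Bool) =
        {decide (0 < (τ (a 2)).re), decide (0 < (τ (a 3)).re)}) →
    (∃ z : L, z ≠ 0 ∧ a 0 * a 1 = a 2 * a 3 * (z * conjRingHomK L z)) →
    ∃ g : GL (Fin 2) L,
      ((g : Matrix (Fin 2) (Fin 2) L).transpose.map (conjRingHomK L)) * Matrix.diagonal ![a 0, a 1] *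
        (g : Matrix (Fin 2) (Fin 2) L) = Matrix.diagonal ![a 2, a 3]

namespace Universe

variable (U : Universe)

/-- **Realisation, PerL setting** (OPEN INPUT; the automorphic–geometric heart of PerL v5 §§3–4). For the data
of PerL Thm 4.4 — `K` sextic CM with frame `φ`, `L = K̃` with `[L:ℚ] ∈ {24, 48}`, `ι₁|_K = φ₁`, types `t` with
PerL's sign table, any `(V₃,h)` — the theta realisation data `U.ThetaRealisation ι₁ V K t (φ 0)` exist: Def 3.2's
seesaw plane with Lemma 3.3's forced signatures (`HodgeCM.Lemma33bLandherr`, `StubTree.pairSum_of_isPerLTypes`),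
the isolation setting of §3.3 with `H_chars` (Lemma 4.2(b)) and `H_occ` (Lemma 4.1(c)), the theta one-forms of
the four types (`Theta ⊆ Uiso`: [Y1neg] v2 Thm 8.1(a)/Prop 6.2; Matsushima–Murakami / Borel–Wallach VII), the
nonvanishing wedge of Prop 4.3 (`lineField`, existential form = PerL v5 tex ll. 639–684; Lemma 4.2(a)'s supply is
derived), Lemma 3.5 in both directions (`gen12`; `real34` in closure form = tex ll. 350–353; Kudla splitting, HKS
seesaw), level change and the Petersson = period identity (`inner_Λ`).  Sources: PerL v5 §§3–4 (blob d912a121,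
`HOME/inputs/2001/`); Gelbart–Rogawski; Rogawski, *Automorphic representations of unitary groups in three variables*
Chs. 12–13; Kudla; Harris–Kudla–Sweet.  WHY IT MIGHT FAIL: the field-by-field notes on `ThetaRealisation`
(`lineField` = the v1→v2 repair point).  Gen 7 (referee A round 10, E1/E2): `lineField` and `real34` were weakened
to their printed forms, so this input no longer asks for more than PerL v5 proves at those two fields.
Up to gen 5 this was the stub `StubTree.realisation_exists_perL`. -/
def RealisationExistsPerL : Prop :=
  ∀ (K L : CMField) (j : K →+* L), IsNormalClosure ℚ K L →
    Module.finrank ℚ K = 6 → (Module.finrank ℚ L = 24 ∨ Module.finrank ℚ L = 48) →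
    ∀ (φ : Fin 3 → (K →+* ℂ)), IsFrame φ →
    ∀ (ι₁ : L →+* ℂ), ι₁.comp j = φ 0 →
    ∀ (t : Fin 4 → CMType K), IsPerLTypes φ t →
    ∀ (V : HermSpace3 L ι₁), Nonempty (U.ThetaRealisation ι₁ V K t (φ 0))

/-- **Realisation, face setting** (OPEN INPUT) = the six-item transposition audit of rfwf v3 §4.2: the proof of
PerL Thm 4.4 uses of its four types only (T1) the pair-sum identity (`HodgeCM.pairSum_psi`), (T2) pairwise
distinctness (`StubTree.psi_injective`) and (T3) inputs stated over an arbitrary CM field — Lemma 3.5, Lemma 4.1(c),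
Lemma 4.2, Prop 3.6/Thm 3.7 (abstract: `Perl34.TorusData.C1_prop36`, `Perl34.IsolationSetting.C2_thm37`), the
archimedean test-vector lemma, Rallis, the line field.  Hence the realisation data exist for `K = L = F` Galois CM
with `[F:ℚ] ≥ 6`, any face `f`, any admissible `ι₁` (`HodgeCM.admissible_mem_psi`) and any `(V₃,h)`.  Up to
gen 5 this was the stub `StubTree.realisation_exists_face`. -/
def RealisationExistsFace : Prop :=
  ∀ (F : CMField), IsGalois ℚ F → 6 ≤ Module.finrank ℚ F →
    ∀ (f : Face F) (ι₁ : F →+* ℂ), f.Admissible ι₁ →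
    ∀ (V : HermSpace3 F ι₁), Nonempty (U.ThetaRealisation ι₁ V F f.psi ι₁)

/-- **The open inputs in the cone of the headline theorems** (gen 6).  `HodgeCM.Assembly.COR_CM` takes
`realisation_face`, `pohlmann_span`, `qw8_sufficiency`; `HodgeCM.Assembly.perL` takes `realisation_perL`;
`HodgeCM.Assembly.COR_CM_of_openInputs` / `perL_of_openInputs` take the whole record.  A `Prop`-valued
structure: supplying an instance for the intended model is exactly the remaining mathematics (SKELETON.md §4).  The four `Prop`s carry no `ModelAxioms` binder: they are asserted for `U` outright and are meant to be supplied TOGETHER WITH `M : U.ModelAxioms` for the intended model (every consumer takes both; referee A, G5). -/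
structure OpenInputs : Prop where
  /-- PerL v5 §§3–4: the theta realisation exists in the PerL setting. -/
  realisation_perL : U.RealisationExistsPerL
  /-- rfwf v3 §4.2: the theta realisation exists over a Galois CM field and any rank-four face. -/
  realisation_face : U.RealisationExistsFace
  /-- Pohlmann's span theorem in PRODUCT form (a PUBLISHED theorem, cited not formalised: Gao–Ullmo, J. Inst. Math. Jussieu 25 (2025) no. 1, 215–249 = arXiv:2411.12249, Thm 3.1 ‘(Pohlmann)’ — the CM-algebra form, with proof, covering products; Pohlmann 1968 Thm 1 = the simple case; Deligne 1982 I §5; also stated in Milne arXiv:2010.08857 §1 ¶1.2; typed form [QW8] L2.2): Hodge classes of `∏ A_Θ` lie in the span of Hodge-weight vectors. -/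
  pohlmann_span : U.PohlmannSpan
  /-- [QW8] Thm 2.5 + §3 + Milne 1999 Cor 4.5: face-generated Lefschetz character ⇒ algebraic. -/
  qw8_sufficiency : U.Qw8Sufficiency

end Universe

end HodgeCM

end
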